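import Summits.HodgeConjecture.HodgeConjecture.Theorems.F0P3cStCharTSEllLin       -- ★ «ELL-LIN» (LH6-p01): `integrable_innerG_integrand`, the `L²(D_G)` domain
import Literature.NumberTheory.Rogawski1990.Ch12Sec5                              -- ★ TR carpet: `WeylIntegrationFormula`, `UpSpec`, `IsClassFunOn`
import Literature.NumberTheory.Rogawski1990.Ch12Sec5UpSpecLB                      -- ★ p852414 (F0P3-p02, ROAD «UP-TR» D1′): `UpSpecLB` — clause 3 under the locally-bounded antecedent (ED. 2)
import Literature.NumberTheory.Rogawski1990.Ch12Sec6                              -- ★ TR carpet: `IsPseudoCoeff` (via `Ch12Sec5Defs`), `PseudoCoeffTrace`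
import Literature.NumberTheory.Rogawski1990.LocalTransferFundamentalLemma         -- ★ `IsLocSmooth`
import Mathlib.MeasureTheory.Function.LocallyIntegrable
import HarnessLib

/-!
# F0 · P3c · line LH6 «StCharTS» — «Sa-COMPOSE★» piece K1b «UP-PSEUDO»: `Tr ρ(f_π^H) = ⟨χ^G_ρ, χ_π⟩_{G,e}` for a pseudo-coefficient `f_π` and a transfer `f_π^H`,
# DERIVED from the carpet relations `WeylIntegrationFormula` + `UpSpec` [Rogawski1990 §12.5] and Harish-Chandra regularity on `H`, over a datum `𝔇 : EllipticData G H`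

Cell `pub/hodgecm-mathlib`, crux H413 = `stmt-HodgeConjecture-24833` (lane `--supports … --as helper`), route HCCMUnconditional; seat LH6-p05 (g0); desk F0P3b-plan (g23)
deal 03:07:39Z «Sa-COMPOSE★».  This file DISCHARGES the hypothesis `hup` («UP-PSEUDO», typer text (T6) of 03:31Z) of ★ K1∕K2 `F0P3cStCharTSScFin`
(`finite_supercuspidal_members`, `finite_isL2_innerG_ne_zero`) from carpet relations and the SAME print-implicit residue lines LH6-p01's ★ «ELL-COMPOSE» uses
((M1H), (UPR)), plus three datum-coherence lines about the Cartan representatives.  THEOREMS ONLY, sorry-free, GENERIC over `𝔇 : EllipticData G H`.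
HONEST LABEL: HC_CM is proved only modulo the 7 printed citations (2 remaining: hLiu418 = `stmt-HodgeConjecture-24832`, h413 = `stmt-HodgeConjecture-24833`) until
rung 0 closes; count-neutral, hypothesis-fed.

THE MATHEMATICS.  [Rogawski1990, §12.6 p. 187] «By the Weyl integration formula, `Tr(π′(f_π)) = ⟨χ_{π′}, χ_π⟩_e`»; the same computation with ANY locally integrable class
function `α` in place of `χ_{π′}` gives `∫_G f_π(g) α(g) dg = ⟨α, χ_π⟩_e` (§1: the Weyl integration formula [§12.5 p. 182] over all Cartan representatives, the
pseudo-coefficient's orbital integrals `Φ(γ, f_π) = conj χ_π(γ)` on `G^e` and `0` on `G^r ∖ G^e` [p. 187], so only the elliptic tori contribute); with `α = χ^G_ρ` [§12.5 p. 183: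
`∫_G f·χ^G_ρ dg = ∫_H f^H·χ_ρ dh` = ★ `UpSpec`] and Harish-Chandra regularity on `H` (`Tr ρ(f^H) = ∫ f^H χ_ρ`) this is print's `χ^G_ρ(f_π) = ⟨χ^G_ρ, χ_π⟩_e` [p. 191, p. 193] (§2).

* §1 `integral_pseudoCoeff_mul_eq_innerG` — `∫ f_π·α dμG = ⟨α, χ_π⟩_{G,e}` for `α` a measurable, locally integrable class function on `G^r` in the `L²(D_G)` domain.
* §2 `packetTrace_transfer_eq_innerG_up` — «UP-PSEUDO»: `Σ_{σ∈ρ} Tr σ(f^H) = ⟨(χ_ρ)^G, χ_π⟩_{G,e}` for a pseudo-coefficient `f = f_π` and a transfer `f^H` (`𝔇.IsTransfer f f^H`).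

## References
* [Rogawski1990] J. D. Rogawski, *Automorphic Representations of Unitary Groups in Three Variables*, Ann. of Math. Stud. 123 (1990): §12.5 pp. 182–184 (Weyl integration
  formula, `α ↦ α^G`, `⟨ , ⟩_e`); §12.6 p. 187 (pseudo-coefficients); §12.7 L. 12.7.2 proof pp. 191–193.
-/

set_option autoImplicit false
-- the mandated namespace has the single-problem summit's repeated segment (`HodgeConjecture.HodgeConjecture`)
set_option linter.dupNamespace false

noncomputable section

open MeasureTheory Filter Topology
open scoped BigOperators ComplexConjugate

namespace Summit.HodgeConjecture.HodgeConjecture.Cruxes.H413.F0P3cStCharTSUpPseudo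

open Literature.NumberTheory.Rogawski1990.Ch12Sec5 Literature.NumberTheory.Rogawski1990 Literature.NumberTheory.Automorphic
open Summit.HodgeConjecture.HodgeConjecture.Cruxes.H413

variable {G H : Type} [Group G] [TopologicalSpace G] [IsTopologicalGroup G] [MeasurableSpace G]
  [∀ γ : G, MeasurableSpace (G ⧸ Subgroup.centralizer ({γ} : Set G))] [MeasurableSpace (G ⧸ Subgroup.center G)]
  [Group H] [TopologicalSpace H] [IsTopologicalGroup H] [MeasurableSpace H]
  (𝔇 : EllipticData G H)

/-! ## §1 `∫ f_π·α dg = ⟨α, χ_π⟩_{G,e}` (Weyl integration + pseudo-coefficient orbital integrals) -/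

/-- **`∫_G f_π(g) α(g) dg = ⟨α, χ_π⟩_{G,e}`** for a pseudo-coefficient `f_π` of `π` and a measurable, locally integrable class function `α` on `G^r` in the `L²(D_G)`
domain — the Weyl integration formula [§12.5 p. 182] over all Cartan representatives; on an elliptic representative `Φ(γ, f_π) = conj χ_π(γ)` a.e., on a non-elliptic one
`Φ(γ, f_π) = 0` a.e. [p. 187], so the sum collapses to the elliptic inner product [p. 184].  Datum coherence used: `cartanG ⊆ cartanAll`; the elliptic representatives lie
a.e. in `G^e`; the others a.e. in `G^r ∖ G^e`. [cite: Rogawski1990, §12.6 p. 187; §12.5 pp. 182–184] -/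
theorem integral_pseudoCoeff_mul_eq_innerG [OpensMeasurableSpace G] [T2Space G]
    (hW : 𝔇.WeylIntegrationFormula) (hsub : 𝔇.cartanG ⊆ 𝔇.cartanAll)
    (hTell : ∀ T ∈ 𝔇.cartanG, ∀ᵐ t : ↥T ∂(𝔇.μT T), (t : G) ∈ 𝔇.ellG)
    (hTnon : ∀ T ∈ 𝔇.cartanAll, T ∉ 𝔇.cartanG → ∀ᵐ t : ↥T ∂(𝔇.μT T), (t : G) ∈ 𝔇.regG ∧ (t : G) ∉ 𝔇.ellG)
    {α : G → ℂ} (hαm : Measurable α) (hαcl : IsClassFunOn 𝔇.regG α) (hαli : LocallyIntegrable α 𝔇.μG)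
    (hαdom : ∀ T ∈ 𝔇.cartanG, MemLp (fun t : ↥T => (𝔇.DG (t : G) : ℂ) * α (t : G)) 2 (𝔇.μT T))
    {π : IrrClass G} (hπdom : ∀ T ∈ 𝔇.cartanG, MemLp (fun t : ↥T => (𝔇.DG (t : G) : ℂ) * 𝔇.char π (t : G)) 2 (𝔇.μT T))
    {f : G → ℂ} (hf : 𝔇.IsPseudoCoeff π f) :
    ∫ g, f g * α g ∂𝔇.μG = 𝔇.innerG α (𝔇.char π) := by
  classical
  obtain ⟨hfS, hf0, hfe⟩ := hf
  -- `f α` is integrable: `f` is continuous with compact support, `α` locally integrable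
  have hfc : Continuous f := hfS.1.continuous
  have hfI : Integrable (fun g => f g * α g) 𝔇.μG := hαli.integrable_smul_left_of_hasCompactSupport hfc hfS.2
  -- the torus integrands: a.e. equal to `D² α conj χ_π` on elliptic representatives, to `0` on the others
  have hell_ae : ∀ T ∈ 𝔇.cartanG, (fun t : ↥T => (𝔇.DG (t : G) : ℂ) ^ 2 * 𝔇.orbInt (t : G) f * α (t : G)) =ᵐ[𝔇.μT T]
      fun t : ↥T => (𝔇.DG (t : G) : ℂ) ^ 2 * α (t : G) * conj (𝔇.char π (t : G)) := fun T hT =>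
    (hTell T hT).mono fun t ht => by
      show (𝔇.DG (t : G) : ℂ) ^ 2 * 𝔇.orbInt (t : G) f * α (t : G) = (𝔇.DG (t : G) : ℂ) ^ 2 * α (t : G) * conj (𝔇.char π (t : G))
      rw [hfe _ ht]
      ring
  have hnon_ae : ∀ T ∈ 𝔇.cartanAll, T ∉ 𝔇.cartanG → (fun t : ↥T => (𝔇.DG (t : G) : ℂ) ^ 2 * 𝔇.orbInt (t : G) f * α (t : G)) =ᵐ[𝔇.μT T]
      fun _ => (0 : ℂ) := fun T hT hTn =>
    (hTnon T hT hTn).mono fun t ht => by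
      show (𝔇.DG (t : G) : ℂ) ^ 2 * 𝔇.orbInt (t : G) f * α (t : G) = 0
      rw [hf0 _ ⟨ht.1, ht.2⟩, mul_zero, zero_mul]
  have hTint : ∀ T ∈ 𝔇.cartanAll,
      Integrable (fun t : ↥T => (𝔇.DG (t : G) : ℂ) ^ 2 * 𝔇.orbInt (t : G) f * α (t : G)) (𝔇.μT T) := by
    intro T hT
    by_cases hTG : T ∈ 𝔇.cartanG
    · exact (F0P3cStCharTSEllLin.integrable_innerG_integrand 𝔇 (hαdom T hTG) (hπdom T hTG)).congr (hell_ae T hTG).symm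
    · exact (integrable_zero _ ℂ (𝔇.μT T)).congr (hnon_ae T hT hTG).symm
  -- the Weyl integration formula, and the collapse of the sum to the elliptic representatives
  rw [hW f hfS α hαm hαcl hfI hTint]
  unfold EllipticData.innerG
  rw [← Finset.sum_sdiff hsub]
  have hzero : ∑ T ∈ 𝔇.cartanAll \ 𝔇.cartanG, ((weylOrder T : ℂ))⁻¹ *
      ∫ t : ↥T, (𝔇.DG (t : G) : ℂ) ^ 2 * 𝔇.orbInt (t : G) f * α (t : G) ∂(𝔇.μT T) = 0 := by
    refine Finset.sum_eq_zero fun T hT => ?_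
    rw [Finset.mem_sdiff] at hT
    rw [integral_congr_ae (hnon_ae T hT.1 hT.2), integral_zero, mul_zero]
  rw [hzero, zero_add]
  refine Finset.sum_congr rfl fun T hT => ?_
  rw [integral_congr_ae (hell_ae T hT)]

/-! ## §2 «UP-PSEUDO»: `Σ_{σ∈ρ} Tr σ(f_π^H) = ⟨(χ_ρ)^G, χ_π⟩_{G,e}` -/

/-- **«UP-PSEUDO»** — for a pseudo-coefficient `f = f_π` of `π`, a transfer `f^H` (`𝔇.IsTransfer f f^H`, `f^H` smooth compactly supported) and a packet `ρ` (a finite set of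
classes of `H`) whose character `χ_ρ = 𝔇.packetCharH ρ` satisfies Harish-Chandra regularity «`Σ_{σ∈ρ} Tr σ(f^H) = ∫ f^H χ_ρ dh`» (M1H) and is a measurable, locally
integrable stable class function on `H^r`, with `(χ_ρ)^G = 𝔇.up χ_ρ` locally integrable and in the `L²(D_G)` domain (UPR): `Σ_{σ∈ρ} Tr σ(f^H) = ⟨(χ_ρ)^G, χ_π⟩_{G,e}` —
★ `UpSpec` [§12.5 p. 183] turns `∫_H f^H χ_ρ` into `∫_G f (χ_ρ)^G`, and §1 evaluates the latter.  This is the hypothesis `hup` of ★ `F0P3cStCharTSScFin` with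
`x := 𝔇.up (𝔇.packetCharH ρ)`, `R := fun fH => Σ_{σ∈ρ} σ.smoothTrace 𝔇.μH fH`. [cite: Rogawski1990, §12.7 L. 12.7.2 proof pp. 191–193; §12.5 p. 183; §12.6 p. 187] -/
theorem packetTrace_transfer_eq_innerG_up [OpensMeasurableSpace G] [T2Space G] [OpensMeasurableSpace H] [T2Space H]
    (hW : 𝔇.WeylIntegrationFormula) (hUp : 𝔇.UpSpec) (hsub : 𝔇.cartanG ⊆ 𝔇.cartanAll)
    (hTell : ∀ T ∈ 𝔇.cartanG, ∀ᵐ t : ↥T ∂(𝔇.μT T), (t : G) ∈ 𝔇.ellG)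
    (hTnon : ∀ T ∈ 𝔇.cartanAll, T ∉ 𝔇.cartanG → ∀ᵐ t : ↥T ∂(𝔇.μT T), (t : G) ∈ 𝔇.regG ∧ (t : G) ∉ 𝔇.ellG)
    (ρ : Finset (IrrClass H))
    -- (M1H): Harish-Chandra regularity of the packet character on `H`
    (hρm : Measurable (𝔇.packetCharH ρ)) (hρli : LocallyIntegrable (𝔇.packetCharH ρ) 𝔇.μH)
    (hρst : IsStableClassFunOn 𝔇.stConjH 𝔇.regH (𝔇.packetCharH ρ))
    (hρtr : ∀ fH : H → ℂ, IsLocSmooth fH → (∑ σ ∈ ρ, σ.smoothTrace 𝔇.μH fH) = ∫ h, fH h * 𝔇.packetCharH ρ h ∂𝔇.μH)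
    -- (UPR): `(χ_ρ)^G` locally integrable, in the `L²(D_G)` domain
    (hUli : LocallyIntegrable (𝔇.up (𝔇.packetCharH ρ)) 𝔇.μG)
    (hUdom : ∀ T ∈ 𝔇.cartanG, MemLp (fun t : ↥T => (𝔇.DG (t : G) : ℂ) * 𝔇.up (𝔇.packetCharH ρ) (t : G)) 2 (𝔇.μT T))
    -- the pseudo-coefficient and its transfer
    {π : IrrClass G} (hπdom : ∀ T ∈ 𝔇.cartanG, MemLp (fun t : ↥T => (𝔇.DG (t : G) : ℂ) * 𝔇.char π (t : G)) 2 (𝔇.μT T))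
    {f : G → ℂ} (hf : 𝔇.IsPseudoCoeff π f) {fH : H → ℂ} (hfH : IsLocSmooth fH) (htr : 𝔇.IsTransfer f fH) :
    (∑ σ ∈ ρ, σ.smoothTrace 𝔇.μH fH) = 𝔇.innerG (𝔇.up (𝔇.packetCharH ρ)) (𝔇.char π) := by
  obtain ⟨hUm, hUcl, hUint⟩ := hUp (𝔇.packetCharH ρ) hρm hρst
  have hfc : Continuous f := hf.1.1.continuous
  have hIfU : Integrable (fun g => f g * 𝔇.up (𝔇.packetCharH ρ) g) 𝔇.μG := hUli.integrable_smul_left_of_hasCompactSupport hfc hf.1.2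
  have hIfH : Integrable (fun h => fH h * 𝔇.packetCharH ρ h) 𝔇.μH := hρli.integrable_smul_left_of_hasCompactSupport hfH.1.continuous hfH.2
  rw [hρtr fH hfH, ← hUint f hf.1 fH htr hIfU hIfH]
  exact integral_pseudoCoeff_mul_eq_innerG 𝔇 hW hsub hTell hTnon hUm hUcl hUli hUdom hπdom hf

/-! ## §3 (ED. 2, ROAD «UP-TR» DEAL #4 (D4-1)) «UP-PSEUDO» under the locally-bounded reading `UpSpecLB` -/

/-- **«UP-PSEUDO», `_LB` TWIN** (ED. 2; ROAD «UP-TR» D1′ ∕ DEAL #4 (D4-1), holder F0P3-p02): the statement of ★ `packetTrace_transfer_eq_innerG_up` with the carpet hypothesis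
`hUp : 𝔇.UpSpec` replaced by the WEAKER ★ `𝔇.UpSpecLB` (clause 3 only for `α` with `D_H · α` locally bounded on `H^r`, [Rogawski1990 §12.5 p. 183] as print USES it) plus the
local-boundedness input `hρB` at `α = χ_ρ` (the ★ `hHBHP` pin's shape; Harish-Chandra on `H`): `Σ_{σ∈ρ} Tr σ(f^H) = ⟨(χ_ρ)^G, χ_π⟩_{G,e}`.  Proof = the ★ body, with `hUint hρB`.
[cite: Rogawski1990, §12.7 L. 12.7.2 proof pp. 191–193; §12.5 p. 183; §12.6 p. 187] [cite: HarishChandra1970, Part VII §1 Thm. 15] -/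
theorem packetTrace_transfer_eq_innerG_up_LB [OpensMeasurableSpace G] [T2Space G] [OpensMeasurableSpace H] [T2Space H]
    (hW : 𝔇.WeylIntegrationFormula) (hUp : 𝔇.UpSpecLB) (hsub : 𝔇.cartanG ⊆ 𝔇.cartanAll)
    (hTell : ∀ T ∈ 𝔇.cartanG, ∀ᵐ t : ↥T ∂(𝔇.μT T), (t : G) ∈ 𝔇.ellG)
    (hTnon : ∀ T ∈ 𝔇.cartanAll, T ∉ 𝔇.cartanG → ∀ᵐ t : ↥T ∂(𝔇.μT T), (t : G) ∈ 𝔇.regG ∧ (t : G) ∉ 𝔇.ellG)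
    (ρ : Finset (IrrClass H))
    -- (M1H): Harish-Chandra regularity of the packet character on `H`
    (hρm : Measurable (𝔇.packetCharH ρ)) (hρli : LocallyIntegrable (𝔇.packetCharH ρ) 𝔇.μH)
    (hρst : IsStableClassFunOn 𝔇.stConjH 𝔇.regH (𝔇.packetCharH ρ))
    (hρtr : ∀ fH : H → ℂ, IsLocSmooth fH → (∑ σ ∈ ρ, σ.smoothTrace 𝔇.μH fH) = ∫ h, fH h * 𝔇.packetCharH ρ h ∂𝔇.μH)
    -- (HCB-H): `D_H · χ_ρ` locally bounded on `H^r` (the antecedent of `UpSpecLB`'s clause 3)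
    (hρB : ∀ C : Set H, IsCompact C → ∃ B : ℝ, ∀ s ∈ C, s ∈ 𝔇.regH → ‖(𝔇.DH s : ℂ) * 𝔇.packetCharH ρ s‖ ≤ B)
    -- (UPR): `(χ_ρ)^G` locally integrable, in the `L²(D_G)` domain
    (hUli : LocallyIntegrable (𝔇.up (𝔇.packetCharH ρ)) 𝔇.μG)
    (hUdom : ∀ T ∈ 𝔇.cartanG, MemLp (fun t : ↥T => (𝔇.DG (t : G) : ℂ) * 𝔇.up (𝔇.packetCharH ρ) (t : G)) 2 (𝔇.μT T))
    -- the pseudo-coefficient and its transfer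
    {π : IrrClass G} (hπdom : ∀ T ∈ 𝔇.cartanG, MemLp (fun t : ↥T => (𝔇.DG (t : G) : ℂ) * 𝔇.char π (t : G)) 2 (𝔇.μT T))
    {f : G → ℂ} (hf : 𝔇.IsPseudoCoeff π f) {fH : H → ℂ} (hfH : IsLocSmooth fH) (htr : 𝔇.IsTransfer f fH) :
    (∑ σ ∈ ρ, σ.smoothTrace 𝔇.μH fH) = 𝔇.innerG (𝔇.up (𝔇.packetCharH ρ)) (𝔇.char π) := by
  obtain ⟨hUm, hUcl, hUint⟩ := hUp (𝔇.packetCharH ρ) hρm hρst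
  have hfc : Continuous f := hf.1.1.continuous
  have hIfU : Integrable (fun g => f g * 𝔇.up (𝔇.packetCharH ρ) g) 𝔇.μG := hUli.integrable_smul_left_of_hasCompactSupport hfc hf.1.2
  have hIfH : Integrable (fun h => fH h * 𝔇.packetCharH ρ h) 𝔇.μH := hρli.integrable_smul_left_of_hasCompactSupport hfH.1.continuous hfH.2
  rw [hρtr fH hfH, ← hUint hρB f hf.1 fH htr hIfU hIfH]
  exact integral_pseudoCoeff_mul_eq_innerG 𝔇 hW hsub hTell hTnon hUm hUcl hUli hUdom hπdom hf

end Summit.HodgeConjecture.HodgeConjecture.Cruxes.H413.F0P3cStCharTSUpPseudo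

end
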